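import Summits.FinalStateConjecture.FinalStateConjecture.Theses.TangentConeAtIPlus
import Literature.Geometry.Lorentzian.KerrHyperboloidalLeaves

/-!
# The `Cone` tube of route TangentConeAtIPlus swallows the whole late half-space
# (negative-side support for crux `DecoratedConeExhausts`, item stmt-FinalStateConjecture-17671)

In the shared `let`-bound predicate `Cone` of the route file
`Summits/FinalStateConjecture/FinalStateConjecture/Theses/TangentConeAtIPlus.lean` (items K1–K4),
hole `i` excises from the flat chart domain the **drifted tube**

  `tube i w := (fun x ↦ x + drᵢ (tᵢ x)) '' {x | dᵢ x ≤ σᵢ (tᵢ x) + w} ∩ {y | T < y 0}`,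

`tᵢ`, `dᵢ` the rest time / rest distance w.r.t. the straight world-line `(Λᵢ, cᵢ)`, and the only
covering clause on the flat chart domain `U` is `{y | T < y 0} \ ⋃ i, tube i 0 ⊆ U`. The profile
`σᵢ : ℝ → ℝ` and the drift `drᵢ : ℝ → E4` are indexed by ALL rest times `s ∈ ℝ` but constrained
only as `s → +∞` (`Continuous`, `(|σᵢ s| + ‖drᵢ s‖)/s → 0` and `σᵢ → ∞` at `atTop`).

We prove (`exists_worm_profile`) that for EVERY motion `(Λ, c)` and EVERY honest continuous
profile `(σ₀, dr₀)` there is a modified continuous profile `(σ, dr)`, EQUAL to `(σ₀, dr₀)` on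
`[s₀, ∞)` — so every `atTop` clause and every clause evaluated at rest times `≥ s₀` is untouched —
whose drifted tube is ALL of `E4`: the rest-early parameters `s → -∞` carry balls of radius
`σ s = σ₀ s₀ + (s₀ - s) → ∞` whose drifted rest time `s₀ + (s - s₀) cos (s - s₀)` oscillates with
unbounded amplitude (pure time drift `dr s = dr₀ s₀ + Λ (ψ s • e₀)`), so every point of `E4` is a
drifted tube point. Consequently (`cone_tube_clauses_of_worm`) the per-hole kinematic clauses of
`Cone` hold for `(σ, dr)` whenever they hold for `(σ₀, dr₀)`, the tube is the whole late
half-space `{y | T < y 0}`, and the covering clause is satisfied by ANY `U`: as typed, `Cone ∧ Holes`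
never force the flat chart to be defined anywhere except where the annulus-agreement clauses look,
i.e. they carry only LOCAL information around each declared hole (vetting note of
stmt-FinalStateConjecture-17671; recommended repair: generate tube points only from rest times
`≥ T`). Pure kinematics in `E4`; no spacetime enters; everything is proved.

## References

* B. O'Neill, *Semi-Riemannian Geometry*, 1983, Ch. 9, pp. 233–236 (Poincaré motions). [folklore]
-/

noncomputable section

set_option linter.dupNamespace false

open Set Filter Topology

namespace Summit.FinalStateConjecture.FinalStateConjecture.Theorems.DecoratedConeExhausts.Negative

open Literature.Geometry.Lorentzian

/-- Level hitting: the drifted rest time `s₀ + (s - s₀) cos (s - s₀)` attains every real value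
`L` at rest-early parameters `s ≤ s₀` with `s₀ - s` as large as we please (intermediate value
theorem on `[s₀ - (2n+1)π, s₀ - 2nπ]`, where it runs from `s₀ + (2n+1)π` down to `s₀ - 2nπ`). [folklore] -/
theorem exists_wormLevel (s₀ L ρ : ℝ) :
    ∃ s ≤ s₀, s₀ + (s - s₀) * Real.cos (s - s₀) = L ∧ ρ ≤ s₀ - s := by
  obtain ⟨n, hn⟩ := exists_nat_ge (max |L - s₀| ρ)
  have hπ := Real.pi_gt_three
  have hn0 : (0 : ℝ) ≤ n := n.cast_nonneg
  set a : ℝ := s₀ - (2 * n + 1) * Real.pi with ha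
  set b : ℝ := s₀ - 2 * n * Real.pi with hb
  have hab : a ≤ b := by rw [ha, hb]; nlinarith
  have hbs : b ≤ s₀ := by rw [hb]; nlinarith
  set u : ℝ → ℝ := fun s ↦ s₀ + (s - s₀) * Real.cos (s - s₀) with hu
  have hu_cont : Continuous u :=
    continuous_const.add ((continuous_id.sub continuous_const).mul
      (Real.continuous_cos.comp (continuous_id.sub continuous_const)))
  have hua : u a = s₀ + (2 * n + 1) * Real.pi := by
    have hcos : Real.cos (a - s₀) = -1 := by
      rw [show a - s₀ = -((n : ℝ) * (2 * Real.pi) + Real.pi) by rw [ha]; ring, Real.cos_neg,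
        Real.cos_nat_mul_two_pi_add_pi]
    simp only [hu, hcos]
    rw [ha]; ring
  have hub : u b = s₀ - 2 * n * Real.pi := by
    have hcos : Real.cos (b - s₀) = 1 := by
      rw [show b - s₀ = -((n : ℝ) * (2 * Real.pi)) by rw [hb]; ring, Real.cos_neg,
        Real.cos_nat_mul_two_pi]
    simp only [hu, hcos]
    rw [hb]; ring
  have hL : L ∈ Set.uIcc (u a) (u b) := by
    rw [hua, hub, Set.uIcc_of_ge (by nlinarith)]
    have h1 : |L - s₀| ≤ n := (le_max_left _ _).trans hn
    rw [abs_le] at h1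
    constructor <;> nlinarith
  obtain ⟨s, hs, hsL⟩ := intermediate_value_uIcc hu_cont.continuousOn hL
  rw [Set.uIcc_of_le hab] at hs
  refine ⟨s, hs.2.trans hbs, hsL, ?_⟩
  have h2 : ρ ≤ n := (le_max_right _ _).trans hn
  have h3 : s ≤ b := hs.2
  rw [hb] at h3
  nlinarith

/-- **The worm profile.** For every motion `(Λ, c)`, every honest continuous profile `(σ₀, dr₀)`
and every `s₀` there is a continuous profile `(σ, dr)` agreeing with `(σ₀, dr₀)` on `[s₀, ∞)` whose
drifted tube `(x ↦ x + dr (t x)) '' {x | d x ≤ σ (t x) + w}` (`t`, `d` = rest time / rest distance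
for `(Λ, c)`, any width `w ≥ 0`) is ALL of `E4`. Witness: `σ s = σ₀ (max s s₀) + (s₀ - min s s₀)`,
`dr s = dr₀ (max s s₀) + Λ (ψ s • e₀)` with `ψ s = (m - s₀) cos (m - s₀) - (m - s₀)`,
`m = min s s₀`. [folklore] -/
theorem exists_worm_profile (Λ : lorentzGroup) (c : E4) {σ₀ : ℝ → ℝ} {dr₀ : ℝ → E4}
    (hσ₀ : Continuous σ₀) (hdr₀ : Continuous dr₀) (s₀ : ℝ) :
    ∃ (σ : ℝ → ℝ) (dr : ℝ → E4), Continuous σ ∧ Continuous dr ∧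
      (∀ s, s₀ ≤ s → σ s = σ₀ s) ∧ (∀ s, s₀ ≤ s → dr s = dr₀ s) ∧
      ∀ w : ℝ, 0 ≤ w →
        (fun x : E4 ↦ x + dr (poincareInv Λ c x 0)) ''
            {x : E4 | E4.spatialNorm (poincareInv Λ c x) ≤ σ (poincareInv Λ c x 0) + w} =
          Set.univ := by
  set Λ' : E4 ≃L[ℝ] E4 := (Λ : E4 ≃L[ℝ] E4) with hΛ'
  set ψ : ℝ → ℝ := fun s ↦ (min s s₀ - s₀) * Real.cos (min s s₀ - s₀) - (min s s₀ - s₀) with hψ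
  have hm : Continuous fun s : ℝ ↦ min s s₀ - s₀ :=
    (continuous_id.min continuous_const).sub continuous_const
  have hψc : Continuous ψ := (hm.mul (Real.continuous_cos.comp hm)).sub hm
  have hψ_le : ∀ {s}, s₀ ≤ s → ψ s = 0 := fun h ↦ by simp [hψ, min_eq_right h]
  have hψ_ge : ∀ {s}, s ≤ s₀ → ψ s = (s - s₀) * Real.cos (s - s₀) - (s - s₀) := fun h ↦ by
    simp [hψ, min_eq_left h]
  refine ⟨fun s ↦ σ₀ (max s s₀) + (s₀ - min s s₀),
    fun s ↦ dr₀ (max s s₀) + Λ' (ψ s • E4.basisVector 0), ?_, ?_, ?_, ?_, ?_⟩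
  · exact (hσ₀.comp (continuous_id.max continuous_const)).add
      (continuous_const.sub (continuous_id.min continuous_const))
  · exact (hdr₀.comp (continuous_id.max continuous_const)).add
      (Λ'.continuous.comp (hψc.smul continuous_const))
  · intro s hs
    simp [max_eq_left hs, min_eq_right hs]
  · intro s hs
    simp [max_eq_left hs, hψ_le hs]
  intro w hw
  refine Set.eq_univ_of_forall fun y ↦ ?_
  set y' : E4 := poincareInv Λ c y with hy'
  set v : E4 := Λ'.symm (dr₀ s₀) with hv
  obtain ⟨s, hs₀, hsL, hsρ⟩ :=
    exists_wormLevel s₀ ((y' - v) 0) (E4.spatialNorm (y' - v) - σ₀ s₀)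
  -- rest-frame coordinates of the candidate preimage `y - dr s`
  have key : poincareInv Λ c (y - (dr₀ (max s s₀) + Λ' (ψ s • E4.basisVector 0))) =
      y' - v - ψ s • E4.basisVector 0 := by
    simp only [poincareInv, max_eq_right hs₀, hy', hv]
    rw [show y - (dr₀ s₀ + Λ' (ψ s • E4.basisVector 0)) - c =
        (y - c) - dr₀ s₀ - Λ' (ψ s • E4.basisVector 0) by abel,
      map_sub, map_sub, ContinuousLinearEquiv.symm_apply_apply]
  have key0 : poincareInv Λ c (y - (dr₀ (max s s₀) + Λ' (ψ s • E4.basisVector 0))) 0 = s := by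
    rw [key]
    have : (y' - v - ψ s • E4.basisVector 0) 0 = (y' - v) 0 - ψ s := by
      simp [E4.basisVector]
    rw [this, hψ_ge hs₀]
    linarith
  refine ⟨y - (dr₀ (max s s₀) + Λ' (ψ s • E4.basisVector 0)), ?_, ?_⟩
  · show E4.spatialNorm (poincareInv Λ c (y - (dr₀ (max s s₀) + Λ' (ψ s • E4.basisVector 0)))) ≤
      σ₀ (max (poincareInv Λ c (y - (dr₀ (max s s₀) + Λ' (ψ s • E4.basisVector 0))) 0) s₀) +
        (s₀ - min (poincareInv Λ c (y - (dr₀ (max s s₀) + Λ' (ψ s • E4.basisVector 0))) 0) s₀) + w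
    rw [key0, key]
    have hsp : E4.spatialNorm (y' - v - ψ s • E4.basisVector 0) = E4.spatialNorm (y' - v) := by
      simp only [E4.spatialNorm, map_sub, map_smul, E4.spatial_basisVector_zero, smul_zero,
        sub_zero]
    rw [hsp, max_eq_right hs₀, min_eq_left hs₀]
    linarith
  · show y - (dr₀ (max s s₀) + Λ' (ψ s • E4.basisVector 0)) +
      (dr₀ (max (poincareInv Λ c (y - (dr₀ (max s s₀) + Λ' (ψ s • E4.basisVector 0))) 0) s₀) +
        Λ' (ψ (poincareInv Λ c (y - (dr₀ (max s s₀) + Λ' (ψ s • E4.basisVector 0))) 0) •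
          E4.basisVector 0)) = y
    rw [key0, sub_add_cancel]

/-- **The covering clause of `Cone` is void.** For every motion `(Λ, c)`, every honest profile
`(σ₀, dr₀)` satisfying the per-hole kinematic clauses of `Cone` (continuity, `(|σ₀ s| + ‖dr₀ s‖)/s → 0`,
`σ₀ → ∞`), every `s₀` and every `T`, the worm profile `(σ, dr)` agrees with `(σ₀, dr₀)` on
`[s₀, ∞)`, satisfies the same clauses, its drifted tube (any width `w ≥ 0`, in the route's exact
shape `… '' {…} ∩ {y | T < y 0}`) IS the late half-space `{y | T < y 0}`, and hence
`{y | T < y 0} \ tube ⊆ U` for every `U` whatsoever. [folklore] -/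
theorem cone_tube_clauses_of_worm (Λ : lorentzGroup) (c : E4) {σ₀ : ℝ → ℝ} {dr₀ : ℝ → E4}
    (hσ₀ : Continuous σ₀) (hdr₀ : Continuous dr₀)
    (hsub : Tendsto (fun s : ℝ ↦ (|σ₀ s| + ‖dr₀ s‖) / s) atTop (𝓝 0))
    (htop : Tendsto σ₀ atTop atTop) (s₀ T : ℝ) :
    ∃ (σ : ℝ → ℝ) (dr : ℝ → E4),
      (∀ s, s₀ ≤ s → σ s = σ₀ s ∧ dr s = dr₀ s) ∧
      (Continuous σ ∧ Continuous dr ∧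
        Tendsto (fun s : ℝ ↦ (|σ s| + ‖dr s‖) / s) atTop (𝓝 0) ∧ Tendsto σ atTop atTop) ∧
      (∀ w : ℝ, 0 ≤ w →
        (fun x : E4 ↦ x + dr (poincareInv Λ c x 0)) ''
              {x : E4 | E4.spatialNorm (poincareInv Λ c x) ≤ σ (poincareInv Λ c x 0) + w} ∩
            {y : E4 | T < y 0} = {y : E4 | T < y 0}) ∧
      ∀ U : Set E4,
        {y : E4 | T < y 0} \
          ((fun x : E4 ↦ x + dr (poincareInv Λ c x 0)) ''
              {x : E4 | E4.spatialNorm (poincareInv Λ c x) ≤ σ (poincareInv Λ c x 0) + 0} ∩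
            {y : E4 | T < y 0}) ⊆ U := by
  obtain ⟨σ, dr, hσ, hdr, hσeq, hdreq, huniv⟩ := exists_worm_profile Λ c hσ₀ hdr₀ s₀
  have heq : ∀ᶠ s in atTop, σ s = σ₀ s ∧ dr s = dr₀ s :=
    (eventually_ge_atTop s₀).mono fun s hs ↦ ⟨hσeq s hs, hdreq s hs⟩
  have htube : ∀ w : ℝ, 0 ≤ w →
      (fun x : E4 ↦ x + dr (poincareInv Λ c x 0)) ''
            {x : E4 | E4.spatialNorm (poincareInv Λ c x) ≤ σ (poincareInv Λ c x 0) + w} ∩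
          {y : E4 | T < y 0} = {y : E4 | T < y 0} := fun w hw ↦ by
    rw [huniv w hw, Set.univ_inter]
  refine ⟨σ, dr, fun s hs ↦ ⟨hσeq s hs, hdreq s hs⟩, ⟨hσ, hdr, ?_, ?_⟩, htube, fun U ↦ ?_⟩
  · exact hsub.congr' (heq.mono fun s hs ↦ by simp only [hs.1, hs.2])
  · exact htop.congr' (heq.mono fun s hs ↦ hs.1.symm)
  · rw [htube 0 le_rfl]
    exact fun y hy ↦ absurd hy.1 hy.2

end Summit.FinalStateConjecture.FinalStateConjecture.Theorems.DecoratedConeExhausts.Negative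

end
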